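import Mathlib
import Literature.AlgebraicGeometry.Tropical.InitialIdeal
import Literature.AlgebraicGeometry.Tropical.TropicalLink

/-!
# TropicalLinks / InductiveStep — initial forms along a coordinate ray: shift and generator lemmas
# (Gröbner dictionary, brick B4, part 1 of 2)

Route `ResolutionOfSingularities/TropicalLinks`, crux `InductiveStep` (stmt-ResolutionOfSingularities-17233),
line `split`, in support of stub `stub_sncClosureSchon` (Luxton–Qu: an snc compactification with
unimodular boundary makes the principal open schön).  The schön clause asks that EVERY initial
degeneration `k[x^±] ⧸ in_w(I')` be regular; after a unimodular change of coordinates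
(`tropicalLinks_isSchonIdeal_map_domCongr_iff`) a nonzero weight is a positive multiple of the
first coordinate, and part 2 (`TropicalLinksInductiveStepRayDegeneration.lean`) identifies the
degeneration along such a coordinate RAY with `𝔾_m ×` (the special fibre `{x₁ = 0}` of the closure
of `V(J)` in the partial compactification `𝔸¹ × T_L ⊇ 𝔾_m × T_L`).  This part supplies the
element-level lemmas, on the split torus with exponent lattice `ℤ × L` (`L` any additive
commutative group), weight `φ = fst` (min-convention initial forms of `Tropical/InitialIdeal`) and
partial compactification `k[ℕ × L] = k[x₁, y^±] ⊆ k[ℤ × L] = k[x₁^±, y^±]`: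

* `tropicalLinks_initialForm_single_one_mul` — `in_φ(x^u f) = x^u in_φ(f)` (monomial shifts);
* `tropicalLinks_initialForm_eq_filter_of_nonneg` — if all weights of `f` are `≥ 0` and `0` occurs,
  `in_φ(f)` is the weight-`0` part of `f`;
* `tropicalLinks_mapDomain_inr_mapDomain_snd_nat`, `tropicalLinks_mem_span_single_of_forall_fst_ne_zero`
  — an element of `k[x₁, y^±]` splits as (part from `k[y^±]`) + (part divisible by `x₁`);
* `tropicalLinks_exists_initialForm_fst_eq_mapDomain_inr` (registered brick) — **generator case of
  the dictionary**: for `f ∈ J` lying in `k[x₁, y^±]` with nonzero constant term in `x₁`,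
  `in_{e₁}(f) = k[inr](r)` with `r` in the FIBRE IDEAL, the restriction to `k[y^±]` of
  `(J ∩ k[x₁, y^±]) + (x₁)` (written with the tree's `Tropical.linkIdeal`; no new definitions).

Standard material (Maclagan–Sturmfels, *Introduction to Tropical Geometry*, §2.4–2.6: initial ideals
and flat degenerations), here as self-contained commutative algebra over any commutative ring `k`.
-/

-- single-problem summit: the doubled namespace component `ResolutionOfSingularities` is forced
set_option linter.dupNamespace false

namespace Summit.ResolutionOfSingularities.ResolutionOfSingularities.Theorems

open AddMonoidAlgebra DirectSum Literature.AlgebraicGeometry.Tropical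

section RayDegeneration

variable {k : Type} [CommRing k] {L : Type} [AddCommGroup L]

/-! ### Small lemmas on initial forms for an additive `ℤ`-valued weight -/

/-- **Initial forms commute with monomial shifts**: `in_φ(x^u · f) = x^u · in_φ(f)` for an additive
weight `φ` (all weights shift by `φ u`). [folklore] -/
theorem tropicalLinks_initialForm_single_one_mul {M : Type} [AddCommGroup M] (φ : M →+ ℤ)
    (u : M) (f : AddMonoidAlgebra k M) :
    initialForm φ (single u (1 : k) * f) = single u (1 : k) * initialForm φ f := by
  apply coeff_injective
  ext w
  rw [coeff_initialForm_apply, coeff_single_mul_apply, coeff_single_mul_apply, one_mul, one_mul,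
    coeff_initialForm_apply]
  have hsupp : ∀ u' : M, u' ∈ (single u (1 : k) * f).coeff.support ↔ -u + u' ∈ f.coeff.support := by
    intro u'
    rw [Finsupp.mem_support_iff, Finsupp.mem_support_iff, coeff_single_mul_apply, one_mul]
  have hiff : (∀ u' ∈ (single u (1 : k) * f).coeff.support, φ w ≤ φ u') ↔
      ∀ v ∈ f.coeff.support, φ (-u + w) ≤ φ v := by
    constructor
    · intro h v hv
      have := h (u + v) ((hsupp (u + v)).2 (by rwa [neg_add_cancel_left]))
      rw [map_add] at this
      rw [map_add, map_neg]
      linarith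
    · intro h u' hu'
      have := h (-u + u') ((hsupp u').1 hu')
      rw [map_add, map_neg, map_add, map_neg] at this
      linarith
  by_cases hc : ∀ v ∈ f.coeff.support, φ (-u + w) ≤ φ v
  · rw [if_pos (hiff.2 hc), if_pos hc]
  · rw [if_neg (mt hiff.1 hc), if_neg hc]

/-- If all exponents of `F` have nonnegative weight and some exponent has weight `0`, the initial
form of `F` is its weight-`0` part. [folklore] -/
theorem tropicalLinks_initialForm_eq_filter_of_nonneg {M : Type} [AddCommGroup M] (φ : M →+ ℤ)
    {F : AddMonoidAlgebra k M} (h0 : ∀ u ∈ F.coeff.support, 0 ≤ φ u) {m₀ : M}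
    (hm₀ : m₀ ∈ F.coeff.support) (hd : φ m₀ = 0) :
    initialForm φ F = ofCoeff (F.coeff.filter fun u => φ u = 0) := by
  rw [initialForm_eq_decompose φ hm₀ (fun u hu => hd ▸ h0 u hu), decompose_gradeBy_coe, hd]

/-! ### The partial compactification `k[ℕ × L] = k[x₁, y^±] ⊆ k[x₁^±, y^±] = k[ℤ × L]` -/

/-- An element of `k[ℕ × L]` all of whose exponents have first component `0` comes from `k[L]`.
[folklore] -/
theorem tropicalLinks_mapDomain_inr_mapDomain_snd_nat {x : AddMonoidAlgebra k (ℕ × L)}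
    (hx : ∀ u ∈ x.coeff.support, u.1 = 0) :
    mapDomain (AddMonoidHom.inr ℕ L) (mapDomain (AddMonoidHom.snd ℕ L) x) = x := by
  apply coeff_injective
  rw [coeff_mapDomain, coeff_mapDomain, ← Finsupp.mapDomain_comp]
  conv_rhs => rw [← Finsupp.mapDomain_id (v := x.coeff)]
  refine Finsupp.mapDomain_congr fun p hp => ?_
  have h1 : p.1 = 0 := hx p hp
  ext
  · simp [h1]
  · simp

/-- An element of `k[x₁, y^±]` all of whose exponents have positive `x₁`-degree is divisible by
`x₁`. [folklore] -/
theorem tropicalLinks_mem_span_single_of_forall_fst_ne_zero {x : AddMonoidAlgebra k (ℕ × L)}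
    (hx : ∀ u ∈ x.coeff.support, u.1 ≠ 0) :
    x ∈ Ideal.span {single ((1 : ℕ), (0 : L)) (1 : k)} := by
  rw [← sum_coeff_single x, Finsupp.sum]
  refine Ideal.sum_mem _ fun u hu => ?_
  obtain ⟨a, l⟩ := u
  obtain ⟨n, hn⟩ := Nat.exists_eq_succ_of_ne_zero (hx _ hu)
  change a = n + 1 at hn
  subst hn
  have h1 : single ((n + 1, l) : ℕ × L) (x.coeff (n + 1, l)) =
      single ((n, l) : ℕ × L) (x.coeff (n + 1, l)) * single ((1 : ℕ), (0 : L)) (1 : k) := by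
    rw [single_mul_single, mul_one, Prod.mk_add_mk, add_zero]
  rw [h1]
  exact Ideal.mul_mem_left _ _ (Ideal.subset_span rfl)

/-- Filtering commutes with an injective change of exponents. [folklore] -/
theorem tropicalLinks_mapDomain_filter {α β R : Type} [AddCommMonoid R] {e : α → β}
    (he : Function.Injective e) (v : α →₀ R) (p : β → Prop) [DecidablePred p]
    [DecidablePred fun a => p (e a)] :
    Finsupp.mapDomain e (v.filter fun a => p (e a)) = (Finsupp.mapDomain e v).filter p := by
  ext b
  rw [Finsupp.filter_apply]
  by_cases hb : b ∈ Set.range e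
  · obtain ⟨a, rfl⟩ := hb
    rw [Finsupp.mapDomain_apply he, Finsupp.mapDomain_apply he, Finsupp.filter_apply]
    by_cases hpa : p (e a)
    · rw [if_pos hpa, if_pos hpa]
    · rw [if_neg hpa, if_neg hpa]
  · rw [Finsupp.mapDomain_notin_range _ _ hb, Finsupp.mapDomain_notin_range _ _ hb, ite_self]

/-- Filters along pointwise-equivalent predicates agree. [folklore] -/
theorem tropicalLinks_filter_congr {α R : Type} [Zero R] (v : α →₀ R) {p q : α → Prop}
    [DecidablePred p] [DecidablePred q] (h : ∀ a, p a ↔ q a) : v.filter p = v.filter q := by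
  ext a
  simp only [Finsupp.filter_apply]
  by_cases hp : p a
  · rw [if_pos hp, if_pos ((h a).1 hp)]
  · rw [if_neg hp, if_neg (mt (h a).2 hp)]

/-- The lattice map `ℕ × L → ℤ × L` of the partial compactification is injective. [folklore] -/
theorem tropicalLinks_castProd_injective :
    Function.Injective ((Nat.castAddMonoidHom ℤ).prodMap (AddMonoidHom.id L)) := by
  rintro ⟨a, b⟩ ⟨c, d⟩ h
  simp only [AddMonoidHom.prodMap, AddMonoidHom.prod_apply, AddMonoidHom.coe_comp,
    Function.comp_apply, AddMonoidHom.coe_fst, AddMonoidHom.coe_snd, Nat.coe_castAddMonoidHom,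
    AddMonoidHom.id_apply, Prod.mk.injEq, Nat.cast_inj] at h
  rw [h.1, h.2]

end RayDegeneration

/-- **Generator case** (registered brick B4-gen).  If `f ∈ J ⊆ k[x₁^±, y^±]` has all `x₁`-degrees
`≥ 0` and some exponent of degree `0` (so that `f ∈ k[x₁, y^±]` and `in_{e₁}(f)` is its degree-`0`
part), then `in_{e₁}(f) = k[inr](r)` for an element `r ∈ k[y^±]` of the fibre ideal — the restriction
to `k[L]` of `(J ∩ k[x₁, y^±]) + (x₁)`. [folklore] -/
theorem tropicalLinks_exists_initialForm_fst_eq_mapDomain_inr :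
    ∀ (k : Type) [CommRing k] (L : Type) [AddCommGroup L] (J : Ideal (AddMonoidAlgebra k (ℤ × L))) (f : AddMonoidAlgebra k (ℤ × L)), f ∈ J → (∀ u ∈ f.coeff.support, 0 ≤ u.1) → ∀ m₀ ∈ f.coeff.support, m₀.1 = 0 → ∃ r ∈ Literature.AlgebraicGeometry.Tropical.linkIdeal (AddMonoidHom.inr ℕ L) (Literature.AlgebraicGeometry.Tropical.linkIdeal ((Nat.castAddMonoidHom ℤ).prodMap (AddMonoidHom.id L)) J ⊔ Ideal.span {AddMonoidAlgebra.single ((1 : ℕ), (0 : L)) (1 : k)}), Literature.AlgebraicGeometry.Tropical.initialForm (AddMonoidHom.fst ℤ L) f = AddMonoidAlgebra.mapDomain (AddMonoidHom.inr ℤ L) r := by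
  intro k _ L _ J f hf h0 m₀ hm₀ hd
  set castP := (Nat.castAddMonoidHom ℤ).prodMap (AddMonoidHom.id L) with hcastP_def
  have hcastP : ∀ u : ℕ × L, castP u = ((u.1 : ℤ), u.2) := fun u => rfl
  have hinj : Function.Injective castP := tropicalLinks_castProd_injective
  -- `f` comes from the partial compactification
  have hrange : (↑f.coeff.support : Set (ℤ × L)) ⊆ Set.range castP := by
    intro u hu
    obtain ⟨n, hn⟩ := Int.eq_ofNat_of_zero_le (h0 u hu)
    exact ⟨(n, u.2), by rw [hcastP]; exact Prod.ext hn.symm rfl⟩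
  set fP : AddMonoidAlgebra k (ℕ × L) := comapDomain castP hinj f with hfP_def
  have hfPf : mapDomain castP fP = f := mapDomain_comapDomain hrange hinj
  have hfPJ : fP ∈ linkIdeal castP J := by
    rw [mem_linkIdeal_iff, hfPf]
    exact hf
  -- split `fP` into its `x₁`-degree-0 part `DP` and the rest `EP ∈ (x₁)`
  set DP : AddMonoidAlgebra k (ℕ × L) := ofCoeff (fP.coeff.filter fun u => u.1 = 0) with hDP_def
  set EP : AddMonoidAlgebra k (ℕ × L) := ofCoeff (fP.coeff.filter fun u => ¬ u.1 = 0) with hEP_def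
  have hsplit : DP + EP = fP := by
    apply coeff_injective
    rw [coeff_add, hDP_def, hEP_def, coeff_ofCoeff, coeff_ofCoeff, Finsupp.filter_add_filter_not]
  have hDPsupp : ∀ u ∈ DP.coeff.support, u.1 = 0 := by
    intro u hu
    rw [hDP_def, coeff_ofCoeff, Finsupp.support_filter, Finset.mem_filter] at hu
    exact hu.2
  have hEPsupp : ∀ u ∈ EP.coeff.support, u.1 ≠ 0 := by
    intro u hu
    rw [hEP_def, coeff_ofCoeff, Finsupp.support_filter, Finset.mem_filter] at hu
    exact hu.2
  set r : AddMonoidAlgebra k L := mapDomain (AddMonoidHom.snd ℕ L) DP with hr_def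
  have hDPr : mapDomain (AddMonoidHom.inr ℕ L) r = DP :=
    tropicalLinks_mapDomain_inr_mapDomain_snd_nat hDPsupp
  clear_value r
  refine ⟨r, ?_, ?_⟩
  · rw [mem_linkIdeal_iff, hDPr, show DP = fP - EP by rw [← hsplit, add_sub_cancel_right]]
    exact Ideal.sub_mem _ (Ideal.mem_sup_left hfPJ)
      (Ideal.mem_sup_right (tropicalLinks_mem_span_single_of_forall_fst_ne_zero hEPsupp))
  · rw [tropicalLinks_initialForm_eq_filter_of_nonneg (AddMonoidHom.fst ℤ L) h0 hm₀ hd]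
    have hcomp : mapDomain (AddMonoidHom.inr ℤ L) r =
        mapDomain castP (mapDomain (AddMonoidHom.inr ℕ L) r) := by
      apply coeff_injective
      rw [coeff_mapDomain, coeff_mapDomain, coeff_mapDomain,
        ← Finsupp.mapDomain_comp (f := ⇑(AddMonoidHom.inr ℕ L)) (g := ⇑castP)]
      refine Finsupp.mapDomain_congr fun l _ => ?_
      rw [Function.comp_apply, hcastP]
      rfl
    rw [hcomp, hDPr, ← hfPf]
    apply coeff_injective
    rw [coeff_ofCoeff, coeff_mapDomain, coeff_mapDomain, hDP_def, coeff_ofCoeff,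
      ← tropicalLinks_mapDomain_filter hinj fP.coeff (fun u : ℤ × L => (AddMonoidHom.fst ℤ L) u = 0)]
    congr 1
    exact tropicalLinks_filter_congr fP.coeff fun u => by
      show (AddMonoidHom.fst ℤ L) (castP u) = 0 ↔ u.1 = 0
      rw [hcastP, AddMonoidHom.coe_fst]
      exact Int.natCast_eq_zero

end Summit.ResolutionOfSingularities.ResolutionOfSingularities.Theorems
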